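import Summits.QuantumFields.BalabanUV.T4Continuum.Support.ScalarAveragedPropagator

/-!
# T⁴ programme, spine node NE2 (U1a), tier B support row B4.d — TWO INVERSES COMPARED THROUGH THE EXCESS OF THEIR OPERATORS:
# `0 ≤ A⁻¹ − A′⁻¹ ≤ A⁻¹(A′ − A)A⁻¹` for `0 ≤ A ≤ A′` (Legendre / completing the square), and form bounds ⇒ norm bounds
# (file 5a of row B4.d; generic finite-dimensional linear algebra)

NE2 formalisation swarm `b2b-balaban-t4-ne2-formalise-*`, seat LEAF PROVER 04, support row B4.d of `t4/formal/NE2/LEAVES.md`.  The scalar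
sandwich law of the row compares `G′_N = (Δ_N + a′Π′_N)⁻¹` with `J₀ᴴG′_{RN}J₀ = (Δ̃ + a′Π′_N)⁻¹` (exact, `Support/OneStepEffectiveOperator` +
`Support/ScalarPlantingDefect`), where `Δ_N ≤ Δ̃`.  This file is the generic comparison step, for Hermitian matrices over `ℂ`:

 * `opNorm_le_of_form_le`: a Hermitian positive semidefinite `Y` with `Re⟨v, Yv⟩ ≤ C‖v‖²` has `‖Y‖ ≤ C` (take `u = Yv`, `t = C` in
   `0 ≤ Re⟨u − tv, Y(u − tv)⟩`);
 * `two_re_sub_form_le` (completing the square `0 ≤ ⟨w − A′⁻¹v, A′(w − A′⁻¹v)⟩`), **`re_form_inv_sub_inv_le`**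
   (`Re⟨v,(A⁻¹ − A′⁻¹)v⟩ ≤ Re⟨A⁻¹v,(A′ − A)A⁻¹v⟩`), **`re_form_inv_sub_inv_nonneg`** (`0 ≤ …` when `0 ≤ A ≤ A′`), and
   **`opNorm_inv_sub_inv_le_of_excess`**: `‖A⁻¹ − A′⁻¹‖ ≤ C` whenever the EXCESS on the range of `A⁻¹` obeys
   `Re⟨A⁻¹v, (A′ − A)A⁻¹v⟩ ≤ C‖v‖²`.

HONEST FRAMING (T4-DAG p. 1).  [folklore] linear algebra, statements OURS; a SUPPORT input of row B4.b (via B4.d), NOT B4, NOT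
[Balaban1985BackgroundPropagators] (3.23)–(3.26) as printed; NE2 NOT proved; NOT infinite volume / mass gap / Clay / summit progress; spine 0/9
unchanged.  HONEST DEPENDENCY: continuum YM on T⁴ ⇐ BetaPertH ∧ nine spine estimates (0/9 proved); BetaPertH ⇐ (D1) ∧ (D4) ∧ CAP+tail;
G-an2-4 gates asym, D1 and NE2/3/4.  ABSOLUTE RULE kept; no `sorry`.
-/

noncomputable section

open scoped BigOperators ComplexConjugate ComplexOrder Matrix Matrix.Norms.L2Operator

namespace Summit.QuantumFields.BalabanUV.T4Continuum.InverseComparison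

open Literature.MathematicalPhysics.QuantumFieldTheory.Balaban1983to89.B5Prop11Lower (nsq nsq_nonneg star_dotProduct_self)
open Summit.QuantumFields.BalabanUV.T4Continuum.ScalarAveragedPropagator (opNorm_le_of_nsq_le_rect)

/-! ## §1 Generic tools: form bounds ⇒ norm bounds; the Legendre comparison of two inverses -/

section Generic

variable {m : Type*} [Fintype m] [DecidableEq m]

omit [DecidableEq m] in
/-- the real part of a Hermitian form is symmetric: `Re⟨u, Yv⟩ = Re⟨v, Yu⟩`. [folklore] -/
theorem re_form_symm {Y : Matrix m m ℂ} (hY : Y.IsHermitian) (u v : m → ℂ) :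
    (star u ⬝ᵥ (Y *ᵥ v)).re = (star v ⬝ᵥ (Y *ᵥ u)).re := by
  have h : star (star v ⬝ᵥ (Y *ᵥ u)) = star u ⬝ᵥ (Y *ᵥ v) := by
    rw [Matrix.star_dotProduct, star_star, Matrix.star_mulVec, hY.eq, Matrix.dotProduct_mulVec]
  rw [← h, Complex.star_def, Complex.conj_re]

omit [DecidableEq m] in
/-- expansion of the form at `u − t·v` (real `t`, Hermitian `Y`). [folklore] -/
theorem re_form_sub_smul {Y : Matrix m m ℂ} (hY : Y.IsHermitian) (u v : m → ℂ) (t : ℝ) :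
    (star (u - (t : ℂ) • v) ⬝ᵥ (Y *ᵥ (u - (t : ℂ) • v))).re
      = (star u ⬝ᵥ (Y *ᵥ u)).re - 2 * t * (star u ⬝ᵥ (Y *ᵥ v)).re + t ^ 2 * (star v ⬝ᵥ (Y *ᵥ v)).re := by
  have hs := re_form_symm hY u v
  simp only [star_sub, star_smul, Matrix.mulVec_sub, Matrix.mulVec_smul, dotProduct_sub, sub_dotProduct, dotProduct_smul,
    smul_dotProduct, Complex.star_def, Complex.conj_ofReal, smul_eq_mul, Complex.sub_re, Complex.mul_re, Complex.ofReal_re,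
    Complex.ofReal_im, zero_mul, sub_zero]
  rw [hs]; ring

/-- **form bound ⇒ norm bound** for a Hermitian positive semidefinite matrix: if `0 ≤ Re⟨v, Yv⟩ ≤ C·Σ|v|²` for all `v` then
`‖Y‖ ≤ C`.  (Take `u = Yv`, `t = C` in `0 ≤ Re⟨u − tv, Y(u − tv)⟩`.) [folklore] -/
theorem opNorm_le_of_form_le {Y : Matrix m m ℂ} (hY : Y.IsHermitian) (hpos : ∀ v, 0 ≤ (star v ⬝ᵥ (Y *ᵥ v)).re) {C : ℝ} (hC : 0 ≤ C)
    (hle : ∀ v, (star v ⬝ᵥ (Y *ᵥ v)).re ≤ C * nsq v) : ‖Y‖ ≤ C := by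
  refine opNorm_le_of_nsq_le_rect Y hC fun v => ?_
  set u := Y *ᵥ v with hu
  -- `Re⟨u, Yv⟩ = Re⟨Yv, Yv⟩ = nsq (Yv)`
  have h1 : (star u ⬝ᵥ (Y *ᵥ v)).re = nsq u := by rw [← hu, star_dotProduct_self, Complex.ofReal_re]
  have h2 := hpos (u - (C : ℂ) • v)
  rw [re_form_sub_smul hY, h1] at h2
  have h3 := hle u
  have h4 := hle v
  by_cases hC0 : C = 0
  · subst hC0
    have h5 := hpos (u - ((1 : ℝ) : ℂ) • v)
    rw [re_form_sub_smul hY, h1] at h5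
    nlinarith [nsq_nonneg u, nsq_nonneg v]
  · have hCpos : 0 < C := lt_of_le_of_ne hC (Ne.symm hC0)
    have h5 : C ^ 2 * (star v ⬝ᵥ (Y *ᵥ v)).re ≤ C ^ 2 * (C * nsq v) := mul_le_mul_of_nonneg_left h4 (sq_nonneg C)
    have h6 : C * nsq u ≤ C * (C ^ 2 * nsq v) := by nlinarith
    exact le_of_mul_le_mul_left h6 hCpos

omit [DecidableEq m] in
/-- `Re⟨v, w⟩ = Re⟨w, v⟩`. [folklore] -/
theorem re_dotProduct_symm (v w : m → ℂ) : (star v ⬝ᵥ w).re = (star w ⬝ᵥ v).re := by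
  rw [Matrix.star_dotProduct, Complex.star_def, Complex.conj_re]

/-- completing the square: for Hermitian invertible `A′ ≥ 0` and every `v, w`,
`2·Re⟨w, v⟩ − Re⟨w, A′w⟩ ≤ Re⟨v, A′⁻¹v⟩`. [folklore] -/
theorem two_re_sub_form_le {A' : Matrix m m ℂ} (hA' : A'.IsHermitian) (hpos : ∀ z, 0 ≤ (star z ⬝ᵥ (A' *ᵥ z)).re)
    (hu : IsUnit A'.det) (v w : m → ℂ) :
    2 * (star w ⬝ᵥ v).re - (star w ⬝ᵥ (A' *ᵥ w)).re ≤ (star v ⬝ᵥ (A'⁻¹ *ᵥ v)).re := by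
  have hinv : (A'⁻¹).IsHermitian := hA'.inv
  have hAG : A' * A'⁻¹ = 1 := Matrix.mul_nonsing_inv _ hu
  set g := A'⁻¹ *ᵥ v with hg
  have hAg : A' *ᵥ g = v := by rw [hg, Matrix.mulVec_mulVec, hAG, Matrix.one_mulVec]
  have key : ∀ z, star g ⬝ᵥ z = star v ⬝ᵥ (A'⁻¹ *ᵥ z) := fun z => by
    rw [hg, Matrix.star_mulVec, hinv.eq, ← Matrix.dotProduct_mulVec]
  have h := hpos (w - g)
  have e1 : (star (w - g) ⬝ᵥ (A' *ᵥ (w - g))).re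
      = (star w ⬝ᵥ (A' *ᵥ w)).re - 2 * (star w ⬝ᵥ v).re + (star v ⬝ᵥ (A'⁻¹ *ᵥ v)).re := by
    simp only [star_sub, Matrix.mulVec_sub, dotProduct_sub, sub_dotProduct, Complex.sub_re]
    rw [hAg, key, key, Matrix.mulVec_mulVec, Matrix.nonsing_inv_mul _ hu, Matrix.one_mulVec, re_dotProduct_symm v w]
    ring
  rw [e1] at h
  linarith

/-- **LEGENDRE COMPARISON, upper half**: for Hermitian invertible `A, A′` with `A′ ≥ 0`,
`Re⟨v, (A⁻¹ − A′⁻¹)v⟩ ≤ Re⟨A⁻¹v, (A′ − A)A⁻¹v⟩`. [folklore] -/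
theorem re_form_inv_sub_inv_le {A A' : Matrix m m ℂ} (hA : A.IsHermitian) (hA' : A'.IsHermitian)
    (hpos' : ∀ z, 0 ≤ (star z ⬝ᵥ (A' *ᵥ z)).re) (hu : IsUnit A.det) (hu' : IsUnit A'.det) (v : m → ℂ) :
    (star v ⬝ᵥ ((A⁻¹ - A'⁻¹) *ᵥ v)).re ≤ (star (A⁻¹ *ᵥ v) ⬝ᵥ ((A' - A) *ᵥ (A⁻¹ *ᵥ v))).re := by
  have hAG : A * A⁻¹ = 1 := Matrix.mul_nonsing_inv _ hu
  set w := A⁻¹ *ᵥ v with hw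
  have hAw : A *ᵥ w = v := by rw [hw, Matrix.mulVec_mulVec, hAG, Matrix.one_mulVec]
  have key : star w ⬝ᵥ v = star v ⬝ᵥ (A⁻¹ *ᵥ v) := by rw [hw, Matrix.star_mulVec, hA.inv.eq, ← Matrix.dotProduct_mulVec]
  have h := two_re_sub_form_le hA' hpos' hu' v w
  rw [key] at h
  rw [Matrix.sub_mulVec, dotProduct_sub, Complex.sub_re, Matrix.sub_mulVec, dotProduct_sub, Complex.sub_re, hAw, key]
  linarith

/-- **LEGENDRE COMPARISON, lower half**: if moreover `A ≥ 0` and `A ≤ A′` then `0 ≤ Re⟨v, (A⁻¹ − A′⁻¹)v⟩`. [folklore] -/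
theorem re_form_inv_sub_inv_nonneg {A A' : Matrix m m ℂ} (hA : A.IsHermitian) (hA' : A'.IsHermitian)
    (hpos : ∀ z, 0 ≤ (star z ⬝ᵥ (A *ᵥ z)).re) (hle : ∀ z, (star z ⬝ᵥ (A *ᵥ z)).re ≤ (star z ⬝ᵥ (A' *ᵥ z)).re)
    (hu : IsUnit A.det) (hu' : IsUnit A'.det) (v : m → ℂ) : 0 ≤ (star v ⬝ᵥ ((A⁻¹ - A'⁻¹) *ᵥ v)).re := by
  have h := re_form_inv_sub_inv_le hA' hA hpos hu' hu v
  have h2 := hle (A'⁻¹ *ᵥ v)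
  rw [Matrix.sub_mulVec, dotProduct_sub, Complex.sub_re, Matrix.sub_mulVec, dotProduct_sub, Complex.sub_re] at h
  rw [Matrix.sub_mulVec, dotProduct_sub, Complex.sub_re]
  linarith

/-- **`‖A⁻¹ − A′⁻¹‖ ≤ C`** whenever `0 ≤ A ≤ A′` (Hermitian, invertible) and the EXCESS on the range of `A⁻¹` is bounded:
`Re⟨A⁻¹v, (A′ − A)A⁻¹v⟩ ≤ C‖v‖²`. [folklore] -/
theorem opNorm_inv_sub_inv_le_of_excess {A A' : Matrix m m ℂ} (hA : A.IsHermitian) (hA' : A'.IsHermitian)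
    (hpos : ∀ z, 0 ≤ (star z ⬝ᵥ (A *ᵥ z)).re) (hle : ∀ z, (star z ⬝ᵥ (A *ᵥ z)).re ≤ (star z ⬝ᵥ (A' *ᵥ z)).re)
    (hu : IsUnit A.det) (hu' : IsUnit A'.det) {C : ℝ} (hC : 0 ≤ C)
    (hX : ∀ v, (star (A⁻¹ *ᵥ v) ⬝ᵥ ((A' - A) *ᵥ (A⁻¹ *ᵥ v))).re ≤ C * nsq v) : ‖A⁻¹ - A'⁻¹‖ ≤ C := by
  have hpos' : ∀ z, 0 ≤ (star z ⬝ᵥ (A' *ᵥ z)).re := fun z => (hpos z).trans (hle z)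
  exact opNorm_le_of_form_le (hA.inv.sub hA'.inv) (re_form_inv_sub_inv_nonneg hA hA' hpos hle hu hu')
    hC fun v => (re_form_inv_sub_inv_le hA hA' hpos' hu hu' v).trans (hX v)

end Generic


end Summit.QuantumFields.BalabanUV.T4Continuum.InverseComparison

end
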